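import Mathlib
import HarnessLib
import Summits.HubbardSuperconductivity.HubbardSuperconductivity.Theorems.KLProgrammeKLRegimeSplitTwoLegIncrementSizesSep

/-!
# Route `KLProgramme` — gen-5 ENGINE child 19918, stub `stub_twoLeg_step`: the slot core `TwoLegCoreT … K (n+1)` from exports of ORDER ≤ 2 ONLY,
# with OFF-DIAGONAL increment moments at orders 1–2 and a K-SEPARATED (E3e) gradient

Cell `gate-hubbard-kl`, seat p1b (g7).  The tree's tier-1 closers for `ℓ_{n+1}` (`twoLegPieceV13_tier1_size_le`, k3c3-p3;
`twoLegCoreT_succ_of_position_exports_explicit/_stub5`, p1b) take the coefficient / position moments of the increment for ALL `k ≤ 4` and with the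
weight `(1 + |Δx̃|)ᵏ`.  Two defects for the fit, both order-bookkeeping, not text: (i) orders 3–4 of the increment's position moments are not
frame-uniform (k3c3-p2 g4 MS-CONSUMER §2: every line carries `e_K`), yet tier 1 never reads them; (ii) the weight charges the spatially LOCAL
`O(U·Λ²_{n+1})` tadpole of the increment to the derivative orders `j = 1, 2`, whose budgets `twoLegBar … j (n+1)` are `O(U²)` — at the shallow
scales `4^{−n} ≳ U` the fit cannot hold; and the (E3e) gradient of `S_{n+1}` read from the FULL first moment of `W^{(n+1)}` contains the
counterterm vertex's coefficient moment (not controlled by `FrameOK`).  This file re-keys the step closer accordingly: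

* part A (`…TwoLegIncrementSizesSep`): `twoLegPieceV13_tier1_size_le_sep` (orders ≤ 2 only), `increment_sep_moments_of_position` (off-diagonal
  moments), `norm_fderiv_evalM_twoLegPoly_le_sep` (K-separated gradient);
* **`twoLegCoreT_succ_of_exports_sep`** / **`_stub5`** / **`_stub5_of_degree_le`** — `TwoLegCoreT hist G P Q R β U μ K (n+1)` from: the full zeroth and
  the OFF-DIAGONAL first/second pinned position moments of the INCREMENT `𝒱^{(n+1)} − 𝒱^{(n)}` (tadpole-free at orders ≥ 1), the frame-Lipschitz
  modulus `ρ_fr` of the increment, the off-diagonal first moment of `𝒱^{(n+1)} − 𝒩_K` + the aliasing size `a₁` (+ `(4/3)Gfr₁U²`) for (E3e), the time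
  moment `Mᵗ` of `𝒱^{(n+1)}` for (E3d), and the fits (`X := 1110`), in the Q5 skeleton's binders.

Proofs only; nothing about the model is asserted.  References: BGM 2006 §2.4 (2.36), (2.40) [cite: BenfattoGiulianiMastropietro2006].
-/

noncomputable section

namespace Summit.HubbardSuperconductivity.HubbardSuperconductivity.Theorems.KLRegimeSplit

set_option linter.dupNamespace false -- summit = problem name (single-conjunct summit), D-0017

open Real Finset
open Literature.MathematicalPhysics.QuantumLattice Literature.MathematicalPhysics.QuantumLattice.BandSectorCounting
open Literature.Probability.LatticeModels
open Summit.HubbardSuperconductivity.HubbardSuperconductivity.Theorems.DispersionFlow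
open Summit.HubbardSuperconductivity.HubbardSuperconductivity.Theorems.PerturbedFermiCurve
open Summit.HubbardSuperconductivity.HubbardSuperconductivity.Theorems.KLProgrammeLegKernels
open Summit.HubbardSuperconductivity.HubbardSuperconductivity.Theorems.TwoLegFourier
open Summit.HubbardSuperconductivity.HubbardSuperconductivity.Theorems.EngineV8

variable {L M : ℕ} [NeZero L] [NeZero M]

/-! ## The step's `TwoLegCoreT` from exports of order ≤ 2 -/

/-- **`TwoLegCoreT hist … K (n+1)` from ORDER-≤-2 exports, NAMED thresholds**: increment moments `Mˢ₀` (full) / `Mˢ♯₁, Mˢ♯₂` (off-diagonal) of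
`𝒱^{(n+1)} − 𝒱^{(n)}`; frame-Lipschitz modulus `ρ_fr` of the increment; (E3e) from the off-diagonal first moment `Mˢ♯₁'` of `𝒱^{(n+1)} − 𝒩_K` and the
aliasing size `a₁`; (E3d) from `Mᵗ` of `𝒱^{(n+1)}`; fits with `X := 1110`. -/
theorem twoLegCoreT_succ_of_exports_sep {R : RenConsts} (hR : ∀ j, 0 ≤ R.Gfr j) {c : ℝ} (hc : 0 < c)
    (hcle : c ≤ klCurveC3 R) {U : ℝ} (hU : 0 < U) (hUle : U ≤ klCurveU0 R) {β : ℝ} (hβmin : klBetaMin ≤ β)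
    (hβc : β ≤ Real.exp (c / U ^ 2)) {μ : ℝ} (hμ : μ ∈ klWindowC) {K : TrigPolyC4v} (hK : FrameOK R U (nScales β) μ K)
    (hist : TrigPolyC4v → ℕ → Prop) (G : GeoConsts) (P : SplitConsts) (Q : EngConsts) (n : ℕ)
    {Ms0 : ℝ} {Msh : ℕ → ℝ}
    (hMs0 : ∀ (σ : Fin 2) (x₀ : SpaceTimeIdx L M), imagTimeWeight β M *
      ∑ x ∈ (univ : Finset (Fin 2 → SpaceTimeIdx L M)).filter (fun x => x 0 = x₀),
        (1 + ((((x 1).2 - (x 0).2) 0).valMinAbs.natAbs : ℝ) + ((((x 1).2 - (x 0).2) 1).valMinAbs.natAbs : ℝ)) ^ 0 *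
          ‖sectorisedKernel L M β (trivialMultiplier L M)
              (klEffectiveAction L M β U μ K klE0 (n + 1) - klEffectiveAction L M β U μ K klE0 n) 2
              (![((0, σ), 0), ((0, σ), 1)] : Fin 2 → SectorLeg 1) x‖ ≤ Ms0)
    (hMsh : ∀ k, 1 ≤ k → k ≤ 2 → ∀ (σ : Fin 2) (x₀ : SpaceTimeIdx L M), imagTimeWeight β M *
      ∑ x ∈ (univ : Finset (Fin 2 → SpaceTimeIdx L M)).filter (fun x => x 0 = x₀ ∧ (x 1).2 ≠ (x 0).2),
        (1 + ((((x 1).2 - (x 0).2) 0).valMinAbs.natAbs : ℝ) + ((((x 1).2 - (x 0).2) 1).valMinAbs.natAbs : ℝ)) ^ k *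
          ‖sectorisedKernel L M β (trivialMultiplier L M)
              (klEffectiveAction L M β U μ K klE0 (n + 1) - klEffectiveAction L M β U μ K klE0 n) 2
              (![((0, σ), 0), ((0, σ), 1)] : Fin 2 → SectorLeg 1) x‖ ≤ Msh k)
    (hfitS : ∀ j ≤ 2, (if j = 0 then 2 * Ms0 else 0) +
      (j.factorial : ℝ) ^ 2 * (2 * j.factorial * 1110 * 200 ^ j) *
        (if j = 0 then 2 * (2 * Ms0) else
          (2 * π + 1) * (2 * Msh 1 * klCurveD1) + (if j = 2 then 2 * Msh 2 * klCurveD1 ^ 2 + 2 * Msh 1 * klCurveD2 else 0)) *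
        (4 + max 1 (((j - 1).factorial : ℝ) / (8 / 5))) ^ j ≤ twoLegBar G Q U j (n + 1))
    -- (E3c-T) frame-Lipschitz modulus of the increment
    {ρfr : ℝ}
    (hρ : ∀ K' : TrigPolyC4v, FrameOK R U (klTempScaleIdx β klE0) μ K' → (∀ j < n + 1, hist K' j) →
      ∀ (σ : Fin 2) (x₀ : SpaceTimeIdx L M), imagTimeWeight β M *
        ∑ x ∈ (univ : Finset (Fin 2 → SpaceTimeIdx L M)).filter (fun x => x 0 = x₀),
          (1 + ((((x 1).2 - (x 0).2) 0).valMinAbs.natAbs : ℝ) + ((((x 1).2 - (x 0).2) 1).valMinAbs.natAbs : ℝ)) ^ 0 *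
            ‖sectorisedKernel L M β (trivialMultiplier L M)
                ((klEffectiveAction L M β U μ K klE0 (n + 1) - klEffectiveAction L M β U μ K klE0 n) -
                  (klEffectiveAction L M β U μ K' klE0 (n + 1) - klEffectiveAction L M β U μ K' klE0 n)) 2
                (![((0, σ), 0), ((0, σ), 1)] : Fin 2 → SectorLeg 1) x‖ ≤ ρfr * frameDist K K')
    (hfitL : 2 * ρfr + 2 * Msh 1 / klCurveD ≤ lipBar G Q U (n + 1))
    -- (E3e) K-separated first moment of `𝒱^{(n+1)} − 𝒩_K` and the aliasing size
    {Msh1' a₁ : ℝ}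
    (hMsh1' : ∀ (σ : Fin 2) (x₀ : SpaceTimeIdx L M), imagTimeWeight β M *
      ∑ x ∈ (univ : Finset (Fin 2 → SpaceTimeIdx L M)).filter (fun x => x 0 = x₀ ∧ (x 1).2 ≠ (x 0).2),
        (1 + ((((x 1).2 - (x 0).2) 0).valMinAbs.natAbs : ℝ) + ((((x 1).2 - (x 0).2) 1).valMinAbs.natAbs : ℝ)) ^ 1 *
          ‖sectorisedKernel L M β (trivialMultiplier L M)
              (klEffectiveAction L M β U μ K klE0 (n + 1) - counterQuadratic L M β K) 2 (![((0, σ), 0), ((0, σ), 1)] : Fin 2 → SectorLeg 1) x‖ ≤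
        Msh1')
    (ha₁ : ∀ p : Momentum, ‖iteratedFDeriv ℝ 1
      (fun p : Momentum => evalM (symInterp L (fun q => K.eval (latticeMomentum L q))) p - evalM K p) p‖ ≤ a₁)
    (hfit1 : 2 * Msh1' + a₁ + 4 / 3 * R.Gfr 1 * U ^ 2 ≤ R.cz * |U| * (cDtmin (-1.2) (-0.05) / 2))
    -- (E3d) time moment of `𝒱^{(n+1)}`
    {Mt : ℝ}
    (hMt : ∀ (σ : Fin 2) (x₀ : SpaceTimeIdx L M), imagTimeWeight β M *
      ∑ x ∈ (univ : Finset (Fin 2 → SpaceTimeIdx L M)).filter (fun x => x 0 = x₀),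
        imagTimeWeight β M * (circDist (2 * M) (x 0).1.val (x 1).1.val : ℝ) *
          ‖sectorisedKernel L M β (trivialMultiplier L M) (klEffectiveAction L M β U μ K klE0 (n + 1)) 2
            (![((0, σ), 0), ((0, σ), 1)] : Fin 2 → SectorLeg 1) x‖ ≤ Mt)
    (hfit2 : 2 * Mt ≤ R.cz * |U|) :
    TwoLegCoreT L M hist G P Q R β U μ K (n + 1) := by
  have ha' : (-4 : ℝ) < -1.1 := by norm_num
  have hab : (-1.1 : ℝ) ≤ -0.1 := by norm_num
  have hb : (-0.1 : ℝ) < 0 := by norm_num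
  obtain ⟨hAf, hA20, hADt, -, ⟨hlo, hhi⟩, -, -⟩ := frame_sizes_of_frameOK_explicit hR hc hcle hU hUle hβmin hβc hμ hK
  have hβ : 0 < β := lt_of_lt_of_le (by unfold klBetaMin; norm_num) hβmin
  have hνC : ∀ k : ℕ, ContDiff ℝ 4 (klLocalPart L M β U μ K k) := fun k =>
    contDiff_klLocalPart (bandBounds ha' hab hb) hAf hADt hlo hhi L M β U k
  -- momentum-side sizes of the increment
  set Mv : ℕ → ℝ := fun k => 2 * (if k = 0 then Ms0 else Msh k) with hMvdef
  have hMv : ∀ k ≤ 2, ∀ q : Momentum, ‖iteratedFDeriv ℝ k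
      (evalM (symInterp L fun p => klLocSelfEnergyRe L M β U μ K (n + 1) p - klLocSelfEnergyRe L M β U μ K n p)) q‖ ≤ Mv k :=
    increment_sep_moments_of_position hβ U μ K n hMs0 hMsh
  have hMv0 : Mv 0 = 2 * Ms0 := by simp [hMvdef]
  have hMv1 : Mv 1 = 2 * Msh 1 := by simp [hMvdef]
  have hMv2 : Mv 2 = 2 * Msh 2 := by simp [hMvdef]
  -- the increment gradient for (E3c)
  have hgΔ : ∀ q : Momentum, ‖fderiv ℝ (fun q : Momentum =>
      evalM (symInterp L (klLocSelfEnergyRe L M β U μ K (n + 1))) q - evalM (symInterp L (klLocSelfEnergyRe L M β U μ K n)) q) q‖ ≤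
      2 * Msh 1 := fun q => by
    have hfun : (fun q : Momentum =>
        evalM (symInterp L (klLocSelfEnergyRe L M β U μ K (n + 1))) q - evalM (symInterp L (klLocSelfEnergyRe L M β U μ K n)) q) =
        evalM (symInterp L fun k => klLocSelfEnergyRe L M β U μ K (n + 1) k - klLocSelfEnergyRe L M β U μ K n k) := by
      funext q; simp only [evalM_apply, eval_symInterp_sub]
    rw [hfun, ← norm_iteratedFDeriv_one, ← hMv1]
    exact hMv 1 (by norm_num) q
  have hMsh10 : 0 ≤ 2 * Msh 1 := (norm_nonneg _).trans (hgΔ 0)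
  refine ⟨⟨?_, fun j hj q => ?_⟩, ?_, ?_⟩
  · have hP := klTwoLegPieceFn_eval_succ (L := L) (M := M) β U μ K n (hνC (n + 1)).continuous (hνC n).continuous
    have hδ : ContDiff ℝ (4 : ℕ∞) (fun θ => klLocalPart L M β U μ K (n + 1) θ - klLocalPart L M β U μ K n θ) := by
      exact_mod_cast (hνC (n + 1)).sub (hνC n)
    have hper : Function.Periodic (fun θ => klLocalPart L M β U μ K (n + 1) θ - klLocalPart L M β U μ K n θ) (2 * π) := fun θ => by
      simp only [klLocalPart_periodic β U μ K (n + 1) θ, klLocalPart_periodic β U μ K n θ]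
    exact_mod_cast contDiff_onM_piece hP hδ hper hμ
  · have h := twoLegPieceV13_tier1_size_le_sep (L := L) (M := M) hR hc hcle hU hUle hβmin hβc hμ hK n hMv hj
      (fun l hl x => norm_iteratedFDeriv_salmhoferCutoff_le_of_le_two (hl.trans hj) x) q
    rw [hMv0, hMv1, hMv2] at h
    exact h.trans (hfitS j hj)
  · refine frameLipschitzFnT_succ_of_increment_responses_explicit (L := L) (M := M) hR hc hcle hU hUle hβmin hβc hμ hK hist G Q n
      (bΔ := 2 * Msh 1) (ρΔ := 2 * ρfr) hMsh10 hgΔ (fun K' hK' hh θ => ?_) (by linarith)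
    have h := abs_increment_eval_sub_le_of_position_moment (L := L) (M := M) hβ U μ K K' n (hρ K' hK' hh) (klFermiPoint μ K' θ)
    linarith
  · -- (E3d/e) with the K-separated gradient of `S_{n+1}`
    have haw : (-4 : ℝ) < -1.2 := by norm_num
    have habw : (-1.2 : ℝ) ≤ -0.05 := by norm_num
    have hbw : (-0.05 : ℝ) < 0 := by norm_num
    set B := bandBounds haw habw hbw with hBdef
    have hBD : B.Dtmin = cDtmin (-1.2) (-0.05) := rfl
    have hAfw : ∀ p : Momentum, ∀ j ≤ 2, ‖iteratedFDeriv ℝ j (frameShift K) p‖ ≤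
        2 * R.Gfr 0 * |U| + 2 * R.Gfr 1 * U ^ 2 + R.Gfr 2 * (c / Real.log 4) := fun p j hj =>
      norm_iteratedFDeriv_frameShift_le_of_frameOK_regime hR hc.le hβmin hβc hK p hj
    obtain ⟨hA20w, hADtw, hhalf⟩ := two_frameSize_lt_cDtmin_wide hR hc.le hcle hU hUle
    have hADt' : 2 * (2 * R.Gfr 0 * |U| + 2 * R.Gfr 1 * U ^ 2 + R.Gfr 2 * (c / Real.log 4)) < B.Dtmin := by rw [hBD]; exact hADtw
    obtain ⟨hloΛ, hhiΛ⟩ := klWindowC_shell_margin hμ hA20w (klScale_klE0_le_klE0 (n + 1))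
    have h13 : 0 ≤ 4 / 3 * R.Gfr 1 * U ^ 2 := by have := hR 1; positivity
    -- the K-separated first-order size of `S_{n+1}`
    have hm1 : ∀ q : Momentum, ‖iteratedFDeriv ℝ 1
        (evalM (symInterp L (fun p => klLocSelfEnergyRe L M β U μ K (n + 1) p - K.eval (latticeMomentum L p)))) q‖ ≤ 2 * Msh1' := by
      intro q
      have hfun : (fun p => klLocSelfEnergyRe L M β U μ K (n + 1) p - K.eval (latticeMomentum L p)) =
          fun p => (∑ σ : Fin 2, ((selfEnergy L M β (klEffectiveAction L M β U μ K klE0 (n + 1) - counterQuadratic L M β K)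
              (omega0 M, p) σ).re +
            (selfEnergy L M β (klEffectiveAction L M β U μ K klE0 (n + 1) - counterQuadratic L M β K) ((omega0 M).rev, p) σ).re)) / 4 :=
        funext (klLocSelfEnergyRe_sub_frame_eq_locRe hβ.ne' U μ K (n + 1))
      rw [hfun]
      exact norm_iteratedFDeriv_evalM_symInterp_locRe_le_offDiag hβ _ le_rfl (by simpa only [pow_one] using hMsh1') q
    have hMsh1'0 : 0 ≤ 2 * Msh1' := (norm_nonneg _).trans (hm1 0)
    have ha₁0 : 0 ≤ a₁ := (norm_nonneg _).trans (ha₁ 0)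
    have hczU : 0 ≤ R.cz * |U| := by
      by_contra hneg
      have hneg' : R.cz * |U| < 0 := lt_of_not_ge hneg
      have : R.cz * |U| * (cDtmin (-1.2) (-0.05) / 2) < 0 := mul_neg_of_neg_of_pos hneg' (by linarith [cDtmin_wide_ge])
      linarith
    set bS : ℝ := 2 * Msh1' + a₁ + 4 / 3 * R.Gfr 1 * U ^ 2 with hbS
    have hbS0 : 0 ≤ bS := by positivity
    have hgradS : ∀ q : Momentum, ‖fderiv ℝ (evalM (symInterp L (klLocSelfEnergyRe L M β U μ K (n + 1)))) q‖ ≤ bS := fun q =>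
      (norm_fderiv_evalM_twoLegPoly_le_sep (L := L) (M := M) hm1 ha₁ q).trans
        (by rw [hbS]; linarith [norm_iteratedFDeriv_one_frameShift_le_of_frameOK hR hK q])
    have hb' : bS ≤ R.cz * |U| * (B.Dtmin - 2 * (2 * R.Gfr 0 * |U| + 2 * R.Gfr 1 * U ^ 2 + R.Gfr 2 * (c / Real.log 4))) :=
      hfit1.trans (mul_le_mul_of_nonneg_left (by rw [hBD]; exact hhalf) hczU)
    refine twoLegSlopes_of_fieldStrength_of_gradient B hAfw hADt' hloΛ hhiΛ (selfEnergySymmetric_all L M β U μ K (n + 1)) ?_ hbS0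
      hgradS hb'
    intro k _
    exact (abs_klFieldStrength_sub_one_le_of_time_moment hβ U μ K (n + 1) k hMt).trans hfit2

/-- **Stub-keyed** (`stub_twoLeg_step`'s literal binders, skeleton 26ce2d93b9f90451: `R.WF2`, `c ≤ klEngC₃3 P R`, `U ≤ klEngU₀3 P R c`,
`G := klEngGeo3`, `Q := klEngQ5 P R`): `TwoLegCoreT hist klEngGeo3 P (klEngQ5 P R) R β U μ K (n+1)` from the ORDER-≤-2 exports of
`twoLegCoreT_succ_of_exports_sep`.  (Under a degree guard `K.degree ≤ L/2` the aliasing size is `a₁ = 0`: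
`iteratedFDeriv_symInterp_latticeValues_sub_eq_zero`.) -/
theorem twoLegCoreT_succ_of_exports_sep_stub5 (P : SplitConsts) {R : RenConsts} (hRW : R.WF2) {c : ℝ} (hc : 0 < c)
    (hcle : c ≤ klEngC₃3 P R) {U : ℝ} (hU : 0 < U) (hUle : U ≤ klEngU₀3 P R c) {β : ℝ} (hβmin : klBetaMin ≤ β)
    (hβc : β ≤ Real.exp (c / U ^ 2)) {μ : ℝ} (hμ : μ ∈ klWindowC) {K : TrigPolyC4v} (hK : FrameOK R U (nScales β) μ K)
    (hist : TrigPolyC4v → ℕ → Prop) (n : ℕ)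
    {Ms0 : ℝ} {Msh : ℕ → ℝ}
    (hMs0 : ∀ (σ : Fin 2) (x₀ : SpaceTimeIdx L M), imagTimeWeight β M *
      ∑ x ∈ (univ : Finset (Fin 2 → SpaceTimeIdx L M)).filter (fun x => x 0 = x₀),
        (1 + ((((x 1).2 - (x 0).2) 0).valMinAbs.natAbs : ℝ) + ((((x 1).2 - (x 0).2) 1).valMinAbs.natAbs : ℝ)) ^ 0 *
          ‖sectorisedKernel L M β (trivialMultiplier L M)
              (klEffectiveAction L M β U μ K klE0 (n + 1) - klEffectiveAction L M β U μ K klE0 n) 2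
              (![((0, σ), 0), ((0, σ), 1)] : Fin 2 → SectorLeg 1) x‖ ≤ Ms0)
    (hMsh : ∀ k, 1 ≤ k → k ≤ 2 → ∀ (σ : Fin 2) (x₀ : SpaceTimeIdx L M), imagTimeWeight β M *
      ∑ x ∈ (univ : Finset (Fin 2 → SpaceTimeIdx L M)).filter (fun x => x 0 = x₀ ∧ (x 1).2 ≠ (x 0).2),
        (1 + ((((x 1).2 - (x 0).2) 0).valMinAbs.natAbs : ℝ) + ((((x 1).2 - (x 0).2) 1).valMinAbs.natAbs : ℝ)) ^ k *
          ‖sectorisedKernel L M β (trivialMultiplier L M)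
              (klEffectiveAction L M β U μ K klE0 (n + 1) - klEffectiveAction L M β U μ K klE0 n) 2
              (![((0, σ), 0), ((0, σ), 1)] : Fin 2 → SectorLeg 1) x‖ ≤ Msh k)
    (hfitS : ∀ j ≤ 2, (if j = 0 then 2 * Ms0 else 0) +
      (j.factorial : ℝ) ^ 2 * (2 * j.factorial * 1110 * 200 ^ j) *
        (if j = 0 then 2 * (2 * Ms0) else
          (2 * π + 1) * (2 * Msh 1 * klCurveD1) + (if j = 2 then 2 * Msh 2 * klCurveD1 ^ 2 + 2 * Msh 1 * klCurveD2 else 0)) *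
        (4 + max 1 (((j - 1).factorial : ℝ) / (8 / 5))) ^ j ≤ twoLegBar klEngGeo3 (klEngQ5 P R) U j (n + 1))
    {ρfr : ℝ}
    (hρ : ∀ K' : TrigPolyC4v, FrameOK R U (klTempScaleIdx β klE0) μ K' → (∀ j < n + 1, hist K' j) →
      ∀ (σ : Fin 2) (x₀ : SpaceTimeIdx L M), imagTimeWeight β M *
        ∑ x ∈ (univ : Finset (Fin 2 → SpaceTimeIdx L M)).filter (fun x => x 0 = x₀),
          (1 + ((((x 1).2 - (x 0).2) 0).valMinAbs.natAbs : ℝ) + ((((x 1).2 - (x 0).2) 1).valMinAbs.natAbs : ℝ)) ^ 0 *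
            ‖sectorisedKernel L M β (trivialMultiplier L M)
                ((klEffectiveAction L M β U μ K klE0 (n + 1) - klEffectiveAction L M β U μ K klE0 n) -
                  (klEffectiveAction L M β U μ K' klE0 (n + 1) - klEffectiveAction L M β U μ K' klE0 n)) 2
                (![((0, σ), 0), ((0, σ), 1)] : Fin 2 → SectorLeg 1) x‖ ≤ ρfr * frameDist K K')
    (hfitL : 2 * ρfr + 2 * Msh 1 / klCurveD ≤ lipBar klEngGeo3 (klEngQ5 P R) U (n + 1))
    {Msh1' a₁ : ℝ}
    (hMsh1' : ∀ (σ : Fin 2) (x₀ : SpaceTimeIdx L M), imagTimeWeight β M *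
      ∑ x ∈ (univ : Finset (Fin 2 → SpaceTimeIdx L M)).filter (fun x => x 0 = x₀ ∧ (x 1).2 ≠ (x 0).2),
        (1 + ((((x 1).2 - (x 0).2) 0).valMinAbs.natAbs : ℝ) + ((((x 1).2 - (x 0).2) 1).valMinAbs.natAbs : ℝ)) ^ 1 *
          ‖sectorisedKernel L M β (trivialMultiplier L M)
              (klEffectiveAction L M β U μ K klE0 (n + 1) - counterQuadratic L M β K) 2 (![((0, σ), 0), ((0, σ), 1)] : Fin 2 → SectorLeg 1) x‖ ≤
        Msh1')
    (ha₁ : ∀ p : Momentum, ‖iteratedFDeriv ℝ 1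
      (fun p : Momentum => evalM (symInterp L (fun q => K.eval (latticeMomentum L q))) p - evalM K p) p‖ ≤ a₁)
    (hfit1 : 2 * Msh1' + a₁ + 4 / 3 * R.Gfr 1 * U ^ 2 ≤ R.cz * |U| * (cDtmin (-1.2) (-0.05) / 2))
    {Mt : ℝ}
    (hMt : ∀ (σ : Fin 2) (x₀ : SpaceTimeIdx L M), imagTimeWeight β M *
      ∑ x ∈ (univ : Finset (Fin 2 → SpaceTimeIdx L M)).filter (fun x => x 0 = x₀),
        imagTimeWeight β M * (circDist (2 * M) (x 0).1.val (x 1).1.val : ℝ) *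
          ‖sectorisedKernel L M β (trivialMultiplier L M) (klEffectiveAction L M β U μ K klE0 (n + 1)) 2
            (![((0, σ), 0), ((0, σ), 1)] : Fin 2 → SectorLeg 1) x‖ ≤ Mt)
    (hfit2 : 2 * Mt ≤ R.cz * |U|) :
    TwoLegCoreT L M hist klEngGeo3 P (klEngQ5 P R) R β U μ K (n + 1) :=
  have hR : ∀ j, 0 ≤ R.Gfr j := hRW.1.2.2
  twoLegCoreT_succ_of_exports_sep (L := L) (M := M) hR hc (hcle.trans (klEngC₃3_le_klCurveC3 P hR)) hU
    (hUle.trans (klEngU₀3_le_klCurveU0 P hR c)) hβmin hβc hμ hK hist klEngGeo3 P (klEngQ5 P R) n hMs0 hMsh hfitS hρ hfitL hMsh1' ha₁ hfit1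
    hMt hfit2

end Summit.HubbardSuperconductivity.HubbardSuperconductivity.Theorems.KLRegimeSplit

end
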